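import Mathlib
import HarnessLib
import HarnessLib.Audit
import Summits.AtomisticToContinuum.Statement
import Literature.Geometry.DiscreteGeometry.KissingPatterns
import Literature.MathematicalPhysics.StatisticalMechanics.BarlowStacking
import Literature.MathematicalPhysics.StatisticalMechanics.HaggStacking
import Literature.MathematicalPhysics.StatisticalMechanics.LennardJonesClusters
import Literature.MathematicalPhysics.StatisticalMechanics.LennardJonesThermodynamicLimitProofs
import Summits.AtomisticToContinuum.Crystallization.Theorems.PalmUnimodularRigidityCrysPeriodicBddBelow
import Summits.AtomisticToContinuum.Crystallization.Theorems.PricedLinkCensusCrysEnergyUpper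
import HarnessLib.Audit.Status.Attr

/-!
Route: HullExactificationCascade

DORMANT since 2026-08-25T05:49:23Z (reconciler: no traction for 7.4 d (last activity item-evidence-added at 2026-08-17T19:03:25Z); parked, not closed — `ledger route dormant route-AtomisticToContinuum-HullExactificationCascade --off` to) — unstaffed, not closed; items shared with open routes are served there. `ledger route dormant <id> --off` reactivates.

# Route HullExactificationCascade — Recurrence exactifies — zero-density defects vanish in the
Lennard-Jones ground-state hull, so only exact (η = 0) classification theorems are ever applied

HULL EXACTIFICATION CASCADE (idea card hull-exactification-cascade; conforming re-filing of the
retired route-AtomisticToContinuum-HullExactification, whose assembly named the Literature decl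
instead of the sub-problem statement — same statements, toy rung dropped, deciding theorem `closes`
now PROVED). It suffices to show X = A ∧ B ∧ C:
(A) ZeroDefectDensity — for every sequence of Lennard-Jones ground states x^N in ℝ³ the fraction of
particles whose first shell (the other particles within 13/10·d_i, d_i = nearest-neighbour
distance), rescaled by d_i, is NOT 1/20-matched after a linear isometry to the fcc pattern
(cuboctahedron, fccKissingPattern) or the hcp pattern (anticuboctahedron, hcpKissingPattern) tends
to 0;
(B) HcpLandscapeGap — for some relaxed hcp parameters (a*, h*) (9/10 < a* < 1, |h* − a*√(2/3)| ≤
a*/100) and every δ, η > 0 there are κ > 0, C with Σ_{y ∈ S∩B_L(c)} siteE_S(y) ≥ 2e(hcp a*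
h*)·#(S∩B_L(c)) + κ·#{η-bad y} − C(L+1)² for every δ-separated, everywhere 1/20-good,
Barlow-templated S ⊆ ℝ³ and every ball (y is η-bad if its unscaled 13/10·a*-shell is not η-congruent
to the hcp(a*,h*) shell): density-priced strict minimality of the relaxed hcp crystal among
perturbed close packings;
(C) RobustBarlowTemplate — a nonempty, δ-separated, everywhere 1/20-good S is the bijective image of
an ideal Barlow stacking barlowStacking 1 √(2/3) s (IsHaggSeq s) under a map 1/20-close to a
similarity on every 13-point cluster.
Ω(x) := the local limits (two-sided ε-matching on every ball, along a subsequence, after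
translations) of a ground-state sequence x — Radin's ground-state hull; it is translation-closed and
closed under re-taking local limits, so a defect class of DENSITY ZERO is absent from some hull
element. Only exact (η = 0) classification theorems are then applied to hull elements.
Lean: `ZeroDefectDensity ∧ HcpLandscapeGap ∧ RobustBarlowTemplate`

## Assembly
DECIDING THEOREM (D-0027 §2.1), glue.lean: `theorem closes : ZeroDefectDensity → HcpLandscapeGap →
RobustBarlowTemplate → HullGoodEverywhere → HullBulkOptimal → HullDefectDensityZero →
HullExactShells → ExactHcpLocalTheorem → HullPeriodicCrystallizes → CrysEnergyUpper →
CrysPeriodicBddBelow → HullEnergyLowerBound → _root_.Crystallization` — PROVED sorry-free in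
Sketch.lean against the verbatim item texts (lean check rc 0; axioms propext, Classical.choice,
Quot.sound; 55 lines of logic plus the proved facts BlancLewin2015_8_holds,
LennardJonesGroundStatesExist_holds, hcpPeriodicConfiguration_points), which also certifies that the
inlined predicates of A…J align. Content: obtain (a, h, ha, hh, box, B-matrix) from B and e := lim
E(N)/N (BlancLewin2015_8_holds; liminf = limsup = e). (i) LennardJonesGroundStatesExist_holds gives
a ground-state sequence x₀; D (fed by A x₀) gives S₁ ∋ 0, δ-separated, everywhere good, relatively
dense, in Ω(x₀); C gives its template; B specialised to S₁ and E give J's hypotheses, so e* :=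
e(hcpPeriodicConfiguration ha hh) ≤ e; I₁ and ciInf_le (I₂) give e ≤ ⨅_Q e(Q) ≤ e*; hence e = e* =
⨅, IsLeast, and E(N)/N → e(P*) — HasPeriodicGroundStateEnergy lennardJones 3. (ii) For an arbitrary
ground-state sequence x: D∘A, C, B|S₁, E and e ≤ e* feed F₀; F gives S₂ ∋ 0 with all shells exactly
hcp(a,h); G gives S₂ = g '' hcpStacking a h = g '' (hcpPeriodicConfiguration ha hh).points; H gives
the clause — IsCrystallizing lennardJones 3. The Assembly item below is the same implication as a
Prop (closed by `closes` in one line).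

Rationale: WHY THIS LINE. Blanc–Lewin's positional statement (16) asks only that SOME translated subsequence of
ground states have SOME non-zero periodic local limit (BlancLewin2015 §2.1 (15)–(17)), and the hull
Ω(x) of all local limits (Radin1991 §2–3, Radin1987; GardnerRadin1979 is the d = 1 Lennard-Jones
instance) is closed under translation and under re-taking local limits, so "defects of density zero
do not exist in some hull element": every analytic input becomes a ZERO-DENSITY statement at a FIXED
tolerance (crux A on the finite ground states, B + E on hull elements) and every geometric input an
EXACT classification theorem of the kind the tree already holds (HalesDSP_layerPackings_holds,
proved; the η = 0 hcp local theorem G, valid off the ideal c/a). Imported, with dictionary: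
topological dynamics of uniformly discrete point sets (orbit closure = Ω(x), minimal-component
heuristics, Radin1991; compactness atop an exact theorem as in AuYeungFrieseckeSchmidt2012),
discrete geometry of twelve-neighbour packings (Hales2012, HalesDSP2012 §1.3,
KusnerKusnerLagariasShlosman2018) for C and G, 1-D lattice-gas domination (HaggStacking.lean, item
0737) and discrete elasticity / Cauchy–Born stability (FrieseckeTheil2002,
doi:10.1007/s00205-006-0031-7) inside B. What it does that the retired CrystalKissingRigidity /
CrystalLocalRigidity and the open routes do not: no rate (no robust Fejes Tóth theorem with linear
rate, cf. item 0758 and BoroczkySzabo2016), no R-window matching of finite ground states (0751), no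
stacking-fault counting (0759), no N^(2/3) shape analysis, no Palm/ergodic machinery (route
PalmUnimodularRigidity) — and conjunct (i) drops out of the same hull argument (J). The negatives
index (DecahedralSoftShell-type refutation of count-only soft kissing at 1/100; multiplicity-blind
finite gluing) is avoided: A delivers PATTERN-closeness, C/G consume it, every configuration
quantified over is injective or δ-separated.

RANKED CRUXES. #2 ZeroDefectDensity (crux) — (A) for every sequence of Lennard-Jones ground states
in ℝ³ the fraction of particles whose rescaled first shell (points within 13/10·d_i, scaled by
d_i⁻¹, recentred) is not 1/20-matched after a linear isometry to fccKissingPattern or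
hcpKissingPattern tends to 0 (card item H3). Tolerance FIXED (LJ-hcp has c/a ≠ √(8/3)); no rate, no
window matching. [difficulty: XL] (why it might fail: Positive density of
polytetrahedral/Frank–Kasper (icosahedral, decahedral-axis) local order in bulk LJ ground states, or
no provable on-average two-shell local energy inequality; tolerance 1/20 and cutoff 13/10·d must
also suit B and C.) [BlancLewin2015, FlatleyTheil2015, Stillinger2001, PartayOrtnerCsanyi2017,
Literature.Barriers.AtomisticToContinuum.IcosahedralClusters,
Literature.Barriers.AtomisticToContinuum.DecahedralSoftShell,
Literature.Barriers.AtomisticToContinuum.TetrahedralFrustration]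
#3 HcpLandscapeGap (crux) — (B) there are a*, h* in the box such that for every δ, η > 0 there are κ
> 0 and C with: for every δ-separated, everywhere 1/20-good (as in A, pointwise on S),
Barlow-templated (as in C) S ⊆ ℝ³ and every ball B_L(c), 2·e(hcpPeriodicConfiguration a*
h*)·#(S∩B_L(c)) + κ·#{y ∈ S∩B_L(c) : unscaled 13/10·a*-shell not η-congruent to the hcp(a*,h*) shell
at 0} − C(L+1)² ≤ Σ_{y ∈ S∩B_L(c)} Σ'_{z ∈ S, z ≠ y} V_LJ(|y − z|) (card items H4 + H5). Since
Σ_{ball} siteE ≥ 2E(n) − C_δL² for ANY δ-separated S, B is a finite-configuration statement: pieces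
of templated configurations with m η-bad sites cost ≥ e*·n + (κ/2)m − CL². [difficulty: XL] (why it
might fail: fcc or a Barlow polytype may beat hcp for (12,6)-LJ (margin ≈ 8e-5·|e*|,
relaxation-sensitive); the Hägg/Peierls gap of 0737 may not survive non-uniform interlayer
relaxation; needs phonon/elastic stability of hcp(a*,h*) with the r⁻⁶ tail.) [Stillinger2001,
BeterminSamajTravenec2022, PartayOrtnerCsanyi2017, FrieseckeTheil2002,
doi:10.1007/s00205-006-0031-7, stmt-AtomisticToContinuum-0737, stmt-AtomisticToContinuum-0670,
Literature.Barriers.AtomisticToContinuum.Hubbard1978_mostHomogeneous]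
#4 RobustBarlowTemplate (crux) — (C) pure metric geometry, no potential: for every δ > 0, every
nonempty δ-separated S ⊆ ℝ³ all of whose points are 1/20-good is Φ(barlowStacking 1 √(2/3) s) for
some Hägg sequence s and a bijection Φ that is 1/20-close to a similarity x ↦ Φp + l_p·A_p(x − p) on
every cluster {q : |q − p| ≤ 1} — the robust form of the PROVED HalesDSP_layerPackings_holds with
the pattern identification supplied as INPUT at every point (no Fejes Tóth / Hales Theorem 1
needed); two non-parallel fault systems cannot coexist in an everywhere-good infinite configuration
(they would meet), foreign points cannot approach a template (covering radius of the
(anti)cuboctahedron 45° < 60°). [difficulty: L] (why it might fail: Tolerance 1/20 may be too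
generous for unambiguous propagation of the layering direction across fcc-type regions (slow
rotation drift at bounded strain); Böröczky–Szabó / KKLS-type flexible twelve-neighbour
constructions are the threat models.) [HalesDSP2012, Hales2012, BoroczkySzabo2016,
KusnerKusnerLagariasShlosman2018, DolbilinLagariasSenechal1998, FrieseckeJamesMuller2002,
Literature.Barriers.AtomisticToContinuum.FlexibleKissingArrangements]
#9 HullGoodEverywhere (support) — (D) EXACTIFICATION no. 1 (card H1): if the 1/20-defect fraction of
a sequence of LJ ground states tends to 0 (A's conclusion for this x), some hull element S
(two-sided ε-matching of translates x^(φ j) + τ_j on every ball, eventually in j — the hypothesis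
shape of PeriodicConfiguration.tendsto_sum_of_eventually_near') is δ-separated, contains 0, is
EVERYWHERE 1/20-good and relatively dense. Pigeonhole gives particles with defect-free R_j-balls,
R_j → ∞; recentre; compactness of δ-separated sets (δ from LennardJonesMinimalDistance_holds) +
diagonal extraction; goodness (open outer cutoff, closed matching ≤ 1/20) passes to local limits;
every particle of a LJ ground state has a neighbour within a uniform R₀ (relocation gains ≥ 1/12),
which bounds the local scale and, with full shells (covering radius 45°), gives relative denseness.
[difficulty: M] [Radin1991, BlancLewin2015, AuYeungFrieseckeSchmidt2012,
tree:CrystallizationLocalLimit.lean, tree:LennardJonesClusters.lean]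
#9 HullBulkOptimal (support) — (E) cut-and-paste (card H2): for LJ ground states x and every
δ-separated hull element S: ∀ ε > 0 ∃ L₀ ∀ L ≥ L₀ ∀ c, Σ_{y ∈ S∩B_L(c)} Σ'_{z ∈ S, z ≠ y} V_LJ(|y −
z|) ≤ 2·e_∞·#(S∩B_L(c)) + εL³, e_∞ = liminf E(N)/N. Proof: with A_j the particles matched to
S∩B_L(c), Σ siteE(A_j) = 2E_self(A_j) + cross and cross ≥ −C_δL² (r⁻⁶ tail); removing A_j and
re-inserting an optimal n-cluster far away (interaction ≤ 0 beyond distance 1) must not lower the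
energy, so E_self + cross ≤ E(n), i.e. Σ siteE ≤ 2E(n) + C_δL² ≤ 2e_∞ n + 2ε'n + CL² (E(n)/n → e_∞
by BlancLewin2015_8_holds; E(n) ≤ 0 for small n). [difficulty: M] [BlancLewin2015,
tree:LennardJonesThermodynamicLimitProofs.lean, tree:LennardJonesClusters.lean]
#9 HullDefectDensityZero (support) — (F₀) real-number bookkeeping: for fixed a, h, S, the
B-inequality for S, the E-inequality for S and liminf E(N)/N ≤ e(hcp a h) give ∀ η > 0 ∀ θ > 0 ∃ L₀
∀ L ≥ L₀ ∀ c, #bad_η(S∩B_L(c)) ≤ θL³ (take ε = κθ/2, absorb C(L+1)² for large L; n ≥ 0). Provable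
now. [difficulty: provable-now] [BlancLewin2015]
#9 HullExactShells (support) — (F) EXACTIFICATION no. 2, inside the hull (card H1 again): a
δ-separated, relatively dense hull element S of x whose η-bad points have density zero uniformly
over balls for EVERY η > 0 yields a hull element S₂ ∋ 0, δ-separated, every point of which is η-good
for every η > 0. Grid/pigeonhole gives η_k-bad-free balls B_(L_k)(y_k) ⊆ S with y_k ∈ S (relative
denseness), L_k → ∞, η_k → 0; a local limit of S − y_k exists (compactness) and lies in Ω(x) (limits
of limits, diagonal argument); η-goodness (open cutoff 13/10·a, closed matching ≤ η, shells of
exactly 12 points at norms < 1.3a) passes to limits and is monotone in η. [difficulty: M]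
[Radin1991, BlancLewin2015, tree:CrystallizationLocalLimit.lean]
#9 ExactHcpLocalTheorem (support) — (G) η = 0 HCP LOCAL THEOREM, valid OFF the ideal ratio: for 9/10
< a < 1, |h − a√(2/3)| ≤ a/100 and nonempty S ⊆ ℝ³ whose every point has its unscaled 13/10·a-shell
η-congruent (linear isometry + bijection) to the 12-point shell of hcpStacking a h at 0 for every η
> 0 (hence exactly congruent: O(3) compact, finitely many bijections), S = g(hcpStacking a h) for an
isometry g. Ideal ratio: scale by 2/a, every tangent arrangement is the HCP pattern ⟹
HalesDSP_layerPackings_holds gives a Barlow stacking, all layers h-type ⟹ Hägg sequence alternating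
⟹ hcp; off-ideal: 6 shell points at a (hexagon) and 6 at √(a²/3 + h²) ≠ a pin the layer plane, which
propagates through 3 shared non-collinear points; uniqueness of the extension at each step is a
finite check on 5-point sub-configurations of the anticuboctahedron; a second copy is excluded
because hcp has covering radius < a. [difficulty: M] [HalesDSP2012, Hales2012,
tree:LayerStackings.lean, ConwaySloane1999]
#9 HullPeriodicCrystallizes (support) — (H) a periodic point set in the hull gives Blanc–Lewin (16):
if some hull element of the LJ ground states x is g(P.points) for a PeriodicConfiguration P and an
isometry g, the IsCrystallizing clause holds for x with multiplicity m ≡ 1: g(P.points) =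
(isometryImage/translate of P).points (CrystallizationSymmetries.lean),
LennardJonesMinimalDistance_holds gives the separation, and the matching is literally hypothesis h
of PeriodicConfiguration.tendsto_sum_of_eventually_near'. Provable now. [difficulty: provable-now]
[BlancLewin2015, tree:CrystallizationLocalLimit.lean, tree:CrystallizationSymmetries.lean]
#9 HullEnergyLowerBound (support) — (J) conjunct (i) from the hull: for a ≠ 0, h ≠ 0 and a
δ-separated, relatively dense S carrying the B-inequality (η = 1, κ-term dropped) and the
E-inequality, e(hcpPeriodicConfiguration a h) ≤ liminf E(N)/N: 2e*·n_L − C(L+1)² ≤ Σ ≤ 2e_∞·n_L +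
εL³ on balls B_L(0), and relative denseness + separation give n_L ≥ c₀L³, so e* − e_∞ ≤ (εL³ +
C(L+1)²)/(2c₀L³) → ε/(2c₀) → 0. Provable now. [difficulty: provable-now] [BlancLewin2015]
#9 CrysEnergyUpper (support) — (I₁ = item 0629 re-wanted verbatim) easy half of energetic
crystallization: limsup E(N)/N ≤ ⨅ over periodic configurations Q of e(Q) (blocks of full cells of Q
as trial states: E(N) ≤ E_self(block) = e(Q)·n − ½cross ≤ e(Q)n + C_Q n^(2/3); r⁻⁶ tail summable in
d = 3; le_ciInf needs no lower bound). [difficulty: M] [BlancLewin2015, Theil2006]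
#9 CrysPeriodicBddBelow (support) — (I₂ = item 0714 re-wanted verbatim) the LJ energy per particle
of periodic configurations of ℝ³ is bounded below (stability BlancLewin2015_9_holds on blocks,
cross-boundary interaction O(n^(2/3)); the tsum junk value 0 is also ≥ −B); makes ⨅_Q e(Q) a genuine
infimum (ciInf_le). [difficulty: S] [BlancLewin2015, tree:LennardJonesThermodynamicLimitProofs.lean]

TWO-LAYER PLAN. Foreseen glued splits (k ≤ 3, depth 1, filed only after a crux moves or a refuter
stamps): B ⇐ B1 → B2 → B3 → B with (B1) Hägg domination surviving (a,h)- and non-uniform interlayer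
relaxation (0737 HaggDominationAllRanges + certified couplings 0670 + a relaxation lemma), (B2)
harmonic and geometric-nonlinear stability of LJ hcp (certified force constants / elastic tensor;
Friesecke–Theil / E–Ming-type discrete Gårding inequality with the summable tail), (B3) boundary and
far-field bookkeeping O(L²) by t⁻³ depth decay plus Σ_ball siteE ≥ 2E(n) − C_δL². A ⇐ an on-average
two-shell local energy inequality + counting (equality-free certificate cards; steep/Mie ladder as
warm-up). G may split into ideal-ratio (HalesDSP_layerPackings_holds + "all shells anticuboctahedral
⟹ alternating Hägg sequence") and off-ideal (two bond lengths pin the layer plane). D/E/F/H/J/F₀ are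
single prover items (recommended order: H, F₀, J, E, D, F, G).

KILL CRITERIA. A refuted (a theorem, or decisive numerics exhibiting a positive fraction of
non-close-packed bulk environments in LJ ground states) closes this and every
sphere-packing-heritage route (close --reason refuted:ZeroDefectDensity). B refuted in the form "a
periodic Barlow polytype P ≠ hcp (e.g. fcc) is the strict minimiser" ⟹ pivot: restate B, F₀, F, G, J
with P (new decls; G becomes the P-local theorem); B refuted as "no density-priced gap at tolerance
1/20 for ANY periodic P" (aperiodic optimal stacking, marginal domination) closes the route. C
refuted at 1/20 by an everywhere-good non-Barlow configuration ⟹ restate A, B, C at a smaller common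
tolerance (A gets harder; the tolerance must stay FIXED and > 1e-4 because LJ-hcp is off the ideal
c/a); C refuted at every fixed tolerance would contradict HalesDSP_layerPackings_holds + compactness
unless uniformity in δ fails — then C is re-filed with δ-dependent tolerance. A proof elsewhere of
HasPeriodicGroundStateEnergy ∧ IsCrystallizing (any open route) moots everything; a proof of
conjunct (i) alone (e_∞ = min e(Q) attained at hcp) moots J and strengthens B's first clause.

NOT DECOMPOSED YET. The interiors of A (local energy inequality, certificate technology) and B
(B1–B3 above), the ideal/off-ideal split of G, and the constants (1/20, 13/10, the hcp box) are
deliberately NOT decomposed at open: they are layer-2 children once a crux closes or a refuter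
stamps a tolerance. The card's RUNG 0 (toy fcc theorem for a designed narrow well with a repulsive
bump at √(8/3), both Blanc–Lewin conjuncts from flyspeck_L12 + FejesTothKissingTwelve + counting +
compactness) is NOT filed in this route: its statement needs the UNPROVED named facts flyspeck_L12 /
FejesTothKissingTwelve, which would make the route's used-constants cone unstaffable (D-0027
staffability); it belongs in a separate conditional-bridge route (conditional on
FejesTothKissingTwelve) or becomes fileable here as support once FejesTothKissingTwelve_holds lands.
No definition requests: hull membership, pointwise goodness, η-congruence and the Barlow template
are INLINED so that every item elaborates now (Sketch.lean rc 0); a later 1:1 supersession may name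
them (IsLocalLimitOfTranslates, ShellPatternClose, HcpShellCongruent, BarlowTemplate).

CHEAPEST FALSIFIER. For B (refuters first): a certified evaluation of e(hcpStacking a h),
e(fccStacking a h), e(dhcp) for V = r⁻¹²/12 − r⁻⁶/6 with (a,h)-relaxation to 1e-7 relative, plus the
Peierls margin −J₂ − Σ_(k≥3)(k−1)|J_k| > 0 on the box (card numerics, uncertified: J₂ = −7.2535e−5,
J₃ = −8.5e−8; lattice-sum arithmetic e = −L₆²/(24L₁₂): e_fcc = −0.71751, e_hcp = −0.71759, hcp lower
by 8e−5, consistent with Stillinger2001, BeterminSamajTravenec2022) — a sign flip retargets B to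
fcc, a vanishing margin kills it. For C: build a 1/20-good non-Barlow configuration by twisting the
layering direction across an fcc slab between two hcp regions (claimed obstruction: two non-parallel
fault systems must meet) or by bounded-strain rotation drift. For A: common-neighbour analysis of
the largest putative LJ global minima (Cambridge Cluster Database, N ≤ 1610): a non-decaying
interior FRACTION of non-fcc/hcp signatures is the warning sign. Run by me (calc/bottleneck.py):
bottleneck distances D5h-shell → cubocta ≈ 0.51, → anticubocta ≈ 0.37, ico → cubocta 0.2313, cubocta
↔ anticubocta 0.378, all ≫ 1/20: these shells are counted defects and the tolerance separates the
patterns.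

NUMBERS. Common tolerance ε₁ = 1/20 (A, B, C); shell cutoff 13/10·d (second fcc/hcp shell at √2·d ≈
1.414d); bottleneck distances on S²: ico–cubocta 0.2313, D5h–cubocta ≈ 0.51, D5h–anticubocta ≈ 0.37,
cubocta–anticubocta 0.378 (calc/bottleneck.py, heuristic minimisation, upper bounds on the minima
that reproduce the jitterbug value to 4 digits); hcp box 9/10 < a < 1, |h − a√(2/3)| ≤ a/100 (LJ: a*
≈ 0.971 r₀, c/a − √(8/3) ≈ 1e−4·√(8/3), Stillinger2001); lattice sums L₆ = 14.4539 (fcc) / 14.4549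
(hcp), L₁₂ = 12.1319 / 12.1323, e = −L₆²/(24 L₁₂): −0.71751 (fcc) vs −0.71759 (hcp); stacking
couplings J₂ ≈ −7.25e−5, J₃ ≈ −8.5e−8 (card, uncertified; margin ≈ 400 against Hubbard-type
degeneracy); minimal distance δ and ground-state existence are the PROVED tree facts
LennardJonesMinimalDistance_holds, LennardJonesGroundStatesExist_holds; e_∞ = lim E(N)/N < 0 is
BlancLewin2015_8_holds (proved).

DEFINITION REQUESTS. None (all predicates inlined; see Not decomposed yet). No cite facts wanted:
every Literature constant in the items and in `closes` is a definition or carries a proved `_holds`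
(IsGroundState, lennardJones, groundStateEnergy, PeriodicConfiguration, energyPerParticle,
fccKissingPattern, hcpKissingPattern, IsHaggSeq, barlowStacking, hcpStacking,
hcpPeriodicConfiguration; BlancLewin2015_8_holds, LennardJonesGroundStatesExist_holds,
LennardJonesMinimalDistance_holds, HalesDSP_layerPackings_holds for the provers of H and G).

Novelty: Searches (2026-08-15, this session; searchd DOWN for `lit search` (rc 75), galaxy up): lit frontier
AtomisticToContinuum --since 2022 (30 rows; crystallization-relevant: arXiv:2407.20762
plane/arbitrary norm, arXiv:2604.19239 Kreutz–Ziereis polycrystals "so far limited to two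
dimensions"; nothing on LJ in d = 3); lit bridges AtomisticToContinuum --cross any (30 rows, none
relevant); lit galaxy search "crystallization conjecture" --star all (13 rows:
Alicandro–Braides–Cicalese monograph panama:492168892383261, Leutbecher Festschrift, Bétermin 2-D
local variational study, Kubin–Ponsiglione arXiv:2004.06820, Cotar–Petrache arXiv:1707.07664, OWR
49/2018, Cohn–Kumar–Miller–Radchenko–Viazovska — none states a hull/exactification route to
Blanc–Lewin (16)); lit galaxy search "kissing number twelve" --star all (1 row: Handbook of Discrete
and Computational Geometry reprint); lit galaxy search --star pdf --mode bm25 "hexagonal close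
packing Lennard-Jones ground state" (12 soft-matter rows, none mathematical); plus the card's and
the retired route's recorded searches (crossref queries → GardnerRadin1979, KubinPonsiglione2021,
CrismaleEtAl2023, Levitov doi:10.1007/bf01218348; two refuter novelty audits walking the
Flatley–Theil citation cone, 22/65 titles; tree search: only CrystallizationLocalLimit.lean, no
orbit-closure/exactification lemma).
Nearest prior art found: Radin1991 §2–3 / Radin1987 / GardnerRadin1979 (ground-state hull,
minimality; lattice models and d = 1 LJ) — the hull l  [refs: 10.1007/bf01218348, 2407.20762, 2604.19239, 2004.06820, 1707.07664, doi:10.1007/bf01218348, GardnerRadin1979, KubinPonsiglione2021, CrismaleEtAl2023, Radin1991, Radin1987, Hales2012, HalesDSP2012, BlancLewin2015, FlatleyTheil2015]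

Barriers (technique_class: ground-state-hull; compactness-exactification; kissing-12): - technique_class: ground-state-hull; compactness-exactification; kissing-12
- Literature.Barriers.AtomisticToContinuum.KissingTwelveDegeneracy: APPLIES to the coordination step
(C/G stop at "Barlow"; AperiodicKissingTwelvePackings_holds: every Hägg walk, aperiodic included, is
kissing-twelve, so aperiodic stackings are legitimate outputs of C). Evaded energetically: crux B
prices c-type layers and strain by a density-proportional gap and exactification F removes them
inside the hull; periodicity is forced potential-specifically, never model-generically.
- Literature.Barriers.AtomisticToContinuum.FlexibleKissingArrangements: APPLIES to inference from
ONE twelve-shell. Evaded: A asks the LJ analysis for PATTERN-closeness directly; the icosahedral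
witness is 0.23 (bottleneck, after optimal rotation) from the cuboctahedron and 0.31 from the
anticuboctahedron, a counted defect at 1/20; C/G use shells at EVERY point of a hull element (global
theorems after exactification). Residual: C's tolerance 1/20 is a bet.
- Literature.Barriers.AtomisticToContinuum.FlexibleKissingArrangementsNarrow: not met — no item
infers ShellCloseTo from count-only data; the count-only single-shell step (0758-type robust Fejes
Tóth) is exactly what this route deletes.
- Literature.Barriers.AtomisticToContinuum.DecahedralSoftShell: not met for the same reason — no
soft-kissing-count ⟹ contact-graph inference anywhere; the D5h decahedral-axis shell is ≈ 0.37 /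
0.51 from the two patterns in bottleneck distan

Novelty grade: new-combination — ROUTE REVIEW (refuter rreview-0815T18-19): KEEP OPEN; full write-up attached as route evidence REVIEW_HullExactificationCascade.md. Conforming re-filing of HullExactification (retired for D-0027 §2.1 only; the 13:52Z review asked exactly this) ⇒ not a recombination of closed routes; closes native-OK (refuter refuter-rreview-0815T18-19-0, 2026-08-15T19:31:56Z; prior: Radin1991 §2-3; BlancLewin2015 §2.1 (16); HalesDSP2012 §1.3; Hales2012; Stillinger2001; overlap: route HullMinimality)

History (route lifecycle, newest last):
- 2026-08-25T05:49:23Z · DORMANT — reconciler: no traction for 7.4 d (last activity item-evidence-added at 2026-08-17T19:03:25Z); parked, not closed — `ledger route dormant route-AtomisticToConti (operator:999:3323365)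

sub-problem: Crystallization · status: dormant · opened planner-plancard-AtomisticToContinuum-Crystal-79d27627-g2-0 2026-08-15T18:49:32Z · rev 1 · ledger route-AtomisticToContinuum-HullExactificationCascade
GENERATED by the gate from the ledger (D-0016/17). Provers cite these decls: `theorem foo : Summit.AtomisticToContinuum.Crystallization.Theses.HullExactificationCascade.<Decl> := …` in Summits/AtomisticToContinuum/Crystallization/Theorems/<Name>.lean.
-/

namespace Summit.AtomisticToContinuum.Crystallization.Theses.HullExactificationCascade

open scoped BigOperators Topology Manifold Classical MeasureTheory ProbabilityTheory Matrix InnerProductSpace ComplexConjugate ContinuousMap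
open Filter Set Function TopologicalSpace MeasureTheory

attribute [summit_statement] _root_.Crystallization

/-- item stmt-AtomisticToContinuum-12086 · crux · rank 2 · open · by planner
why it might fail: Positive density of polytetrahedral/Frank–Kasper (icosahedral, decahedral-axis) local order in bulk LJ ground states, or no provable on-average two-shell local energy inequality; tolerance 1/20 and cutoff 13/10·d must also suit B and C.
sources: BlancLewin2015, FlatleyTheil2015, Stillinger2001, PartayOrtnerCsanyi2017, Literature.Barriers.AtomisticToContinuum.IcosahedralClusters, Literature.Barriers.AtomisticToContinuum.DecahedralSoftShell
[crux] (A) for every sequence of Lennard-Jones ground states in ℝ³ the fraction of particles whose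
rescaled first shell (points within 13/10·d_i, scaled by d_i⁻¹, recentred) is not 1/20-matched after
a linear isometry to fccKissingPattern or hcpKissingPattern tends to 0 (card item H3). Tolerance
FIXED (LJ-hcp has c/a ≠ √(8/3)); no rate, no window matching. [difficulty: XL] -/
@[route_item "route-AtomisticToContinuum-HullExactificationCascade", crux]
def ZeroDefectDensity : Prop :=
  ∀ (x : (N : ℕ) → (Fin N → EuclideanSpace ℝ (Fin 3))), (∀ N, Literature.MathematicalPhysics.StatisticalMechanics.IsGroundState Literature.MathematicalPhysics.StatisticalMechanics.lennardJones (x N)) → Filter.Tendsto (fun N : ℕ => (Nat.card {i : Fin N // ¬ (let d : ℝ := sInf ((fun z => dist z (x N i)) '' (Set.range (x N) \ {(x N i)})); let T : Set (EuclideanSpace ℝ (Fin 3)) := {z : EuclideanSpace ℝ (Fin 3) | z ∈ Set.range (x N) ∧ z ≠ (x N i) ∧ dist z (x N i) < 13 / 10 * d}; ∃ A : EuclideanSpace ℝ (Fin 3) →ₗᵢ[ℝ] EuclideanSpace ℝ (Fin 3), (∃ e : ↥T ≃ ↥Literature.Geometry.DiscreteGeometry.fccKissingPattern, ∀ t : ↥T,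 dist (d⁻¹ • ((t : EuclideanSpace ℝ (Fin 3)) - (x N i))) (A ((e t : ↥Literature.Geometry.DiscreteGeometry.fccKissingPattern) : EuclideanSpace ℝ (Fin 3))) ≤ 1 / 20) ∨ (∃ e : ↥T ≃ ↥Literature.Geometry.DiscreteGeometry.hcpKissingPattern, ∀ t : ↥T, dist (d⁻¹ • ((t : EuclideanSpace ℝ (Fin 3)) - (x N i))) (A ((e t : ↥Literature.Geometry.DiscreteGeometry.hcpKissingPattern) : EuclideanSpace ℝ (Fin 3))) ≤ 1 / 20))} : ℝ) / (N : ℝ)) Filter.atTop (nhds (0 : ℝ))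

/-- item stmt-AtomisticToContinuum-12087 · crux · rank 3 · open · by planner
why it might fail: fcc or a Barlow polytype may beat hcp for (12,6)-LJ (margin ≈ 8e-5·|e*|, relaxation-sensitive); the Hägg/Peierls gap of 0737 may not survive non-uniform interlayer relaxation; needs phonon/elastic stability of hcp(a*,h*) with the r⁻⁶ tail.
sources: Stillinger2001, BeterminSamajTravenec2022, PartayOrtnerCsanyi2017, FrieseckeTheil2002, doi:10.1007/s00205-006-0031-7, stmt-AtomisticToContinuum-0737
[crux] (B) there are a*, h* in the box such that for every δ, η > 0 there are κ > 0 and C with: for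
every δ-separated, everywhere 1/20-good (as in A, pointwise on S), Barlow-templated (as in C) S ⊆ ℝ³
and every ball B_L(c), 2·e(hcpPeriodicConfiguration a* h*)·#(S∩B_L(c)) + κ·#{y ∈ S∩B_L(c) : unscaled
13/10·a*-shell not η-congruent to the hcp(a*,h*) shell at 0} − C(L+1)² ≤ Σ_{y ∈ S∩B_L(c)} Σ'_{z ∈ S,
z ≠ y} V_LJ(|y − z|) (card items H4 + H5). Since Σ_{ball} siteE ≥ 2E(n) − C_δL² for ANY δ-separated
S, B is a finite-configuration statement: pieces of templated configurations with m η-bad sites cost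
≥ e*·n + (κ/2)m − CL². [difficulty: XL] -/
@[route_item "route-AtomisticToContinuum-HullExactificationCascade", crux]
def HcpLandscapeGap : Prop :=
  ∃ a h : ℝ, ∃ ha : a ≠ 0, ∃ hh : h ≠ 0, (9 / 10 < a ∧ a < 1 ∧ |h - a * Real.sqrt (2 / 3)| ≤ a / 100) ∧ (∀ δ : ℝ, 0 < δ → ∀ η : ℝ, 0 < η → ∃ κ : ℝ, 0 < κ ∧ ∃ C : ℝ, ∀ S : Set (EuclideanSpace ℝ (Fin 3)), (∀ y ∈ S, ∀ z ∈ S, y ≠ z → δ ≤ dist y z) → (∀ y ∈ S, (let d : ℝ := sInf ((fun z => dist z y) '' (S \ {y})); let T : Set (EuclideanSpace ℝ (Fin 3)) := {z : EuclideanSpace ℝ (Fin 3) | z ∈ S ∧ z ≠ y ∧ dist z y < 13 / 10 * d}; ∃ A : EuclideanSpace ℝ (Fin 3) →ₗᵢ[ℝ] EuclideanSpace ℝ (Fin 3), (∃ e : ↥T ≃ ↥Literature.Geometry.DiscreteGeometry.fccKissingPattern, ∀ t : ↥T, dist (d⁻¹ • ((t : EuclideanSpace ℝ (Fin 3)) -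 y)) (A ((e t : ↥Literature.Geometry.DiscreteGeometry.fccKissingPattern) : EuclideanSpace ℝ (Fin 3))) ≤ 1 / 20) ∨ (∃ e : ↥T ≃ ↥Literature.Geometry.DiscreteGeometry.hcpKissingPattern, ∀ t : ↥T, dist (d⁻¹ • ((t : EuclideanSpace ℝ (Fin 3)) - y)) (A ((e t : ↥Literature.Geometry.DiscreteGeometry.hcpKissingPattern) : EuclideanSpace ℝ (Fin 3))) ≤ 1 / 20))) → (∃ s : ℤ → ℤ, Literature.MathematicalPhysics.StatisticalMechanics.IsHaggSeq s ∧ ∃ Φ : EuclideanSpace ℝ (Fin 3) → EuclideanSpace ℝ (Fin 3), Set.BijOn Φ (Literature.MathematicalPhysics.StatisticalMechanics.barlowStacking 1 (Real.sqrt (2 / 3)) s) S ∧ ∀ p ∈ Literature.MathematicalPhysics.StatisticalMechanics.barlowStacking 1 (Real.sqrt (2 / 3)) s, ∃ A : EuclideanSpace ℝ (Fin 3) →ₗᵢ[ℝ] EuclideanSpace ℝ (Fin 3), ∃ l : ℝ, 0 < l ∧ ∀ q ∈ Literature.MathematicalPhysics.StatisticalMechanics.barlowStacking 1 (Real.sqrt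 (2 / 3)) s, dist q p ≤ 1 → dist (Φ q) (Φ p + l • A (q - p)) ≤ 1 / 20 * l) → ∀ (c : EuclideanSpace ℝ (Fin 3)) (L : ℝ), 0 ≤ L → 2 * ((Literature.MathematicalPhysics.StatisticalMechanics.hcpPeriodicConfiguration ha hh).energyPerParticle Literature.MathematicalPhysics.StatisticalMechanics.lennardJones) * (({y : EuclideanSpace ℝ (Fin 3) | y ∈ S ∧ dist y c ≤ L} : Set (EuclideanSpace ℝ (Fin 3))).ncard : ℝ) + κ * (({y : EuclideanSpace ℝ (Fin 3) | y ∈ S ∧ dist y c ≤ L ∧ ¬ (let T : Set (EuclideanSpace ℝ (Fin 3)) := {z : EuclideanSpace ℝ (Fin 3) | z ∈ S ∧ z ≠ y ∧ dist z y < 13 / 10 * a}; let P : Set (EuclideanSpace ℝ (Fin 3)) := {p : EuclideanSpace ℝ (Fin 3) | p ∈ Literature.MathematicalPhysics.StatisticalMechanics.hcpStacking a h ∧ p ≠ 0 ∧ ‖p‖ < 13 / 10 * a}; ∃ A : EuclideanSpace ℝ (Fin 3) →ₗᵢ[ℝ] EuclideanSpace ℝ (Fin 3), ∃ e : ↥T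 ≃ ↥P, ∀ t : ↥T, dist ((t : EuclideanSpace ℝ (Fin 3)) - y) (A ((e t : ↥P) : EuclideanSpace ℝ (Fin 3))) ≤ η)} : Set (EuclideanSpace ℝ (Fin 3))).ncard : ℝ) - C * (L + 1) ^ 2 ≤ (∑' y : ↥{y : EuclideanSpace ℝ (Fin 3) | y ∈ S ∧ dist y c ≤ L}, (∑' z : ↥{z : EuclideanSpace ℝ (Fin 3) | z ∈ S ∧ z ≠ (y : EuclideanSpace ℝ (Fin 3))}, Literature.MathematicalPhysics.StatisticalMechanics.lennardJones (dist (y : EuclideanSpace ℝ (Fin 3)) (z : EuclideanSpace ℝ (Fin 3))))))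

/-- item stmt-AtomisticToContinuum-12088 · crux · rank 4 · closed · proved by Summit.AtomisticToContinuum.Crystallization.Theorems.robustBarlowTemplate_proof @ 463c6c30d593 (prover) · by planner
why it might fail: Tolerance 1/20 may be too generous for unambiguous propagation of the layering direction across fcc-type regions (slow rotation drift at bounded strain); Böröczky–Szabó / KKLS-type flexible twelve-neighbour constructions are the threat models.
sources: HalesDSP2012, Hales2012, BoroczkySzabo2016, KusnerKusnerLagariasShlosman2018, DolbilinLagariasSenechal1998, FrieseckeJamesMuller2002
[crux] (C) pure metric geometry, no potential: for every δ > 0, every nonempty δ-separated S ⊆ ℝ³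
all of whose points are 1/20-good is Φ(barlowStacking 1 √(2/3) s) for some Hägg sequence s and a
bijection Φ that is 1/20-close to a similarity x ↦ Φp + l_p·A_p(x − p) on every cluster {q : |q − p|
≤ 1} — the robust form of the PROVED HalesDSP_layerPackings_holds with the pattern identification
supplied as INPUT at every point (no Fejes Tóth / Hales Theorem 1 needed); two non-parallel fault
systems cannot coexist in an everywhere-good infinite configuration (they would meet), foreign
points cannot approach a template (covering radius of the (anti)cuboctahedron 45° < 60°).
[difficulty: L] -/
@[route_item "route-AtomisticToContinuum-HullExactificationCascade", crux]
def RobustBarlowTemplate : Prop :=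
  ∀ δ : ℝ, 0 < δ → ∀ S : Set (EuclideanSpace ℝ (Fin 3)), S.Nonempty → (∀ y ∈ S, ∀ z ∈ S, y ≠ z → δ ≤ dist y z) → (∀ y ∈ S, (let d : ℝ := sInf ((fun z => dist z y) '' (S \ {y})); let T : Set (EuclideanSpace ℝ (Fin 3)) := {z : EuclideanSpace ℝ (Fin 3) | z ∈ S ∧ z ≠ y ∧ dist z y < 13 / 10 * d}; ∃ A : EuclideanSpace ℝ (Fin 3) →ₗᵢ[ℝ] EuclideanSpace ℝ (Fin 3), (∃ e : ↥T ≃ ↥Literature.Geometry.DiscreteGeometry.fccKissingPattern, ∀ t : ↥T, dist (d⁻¹ • ((t : EuclideanSpace ℝ (Fin 3)) - y)) (A ((e t : ↥Literature.Geometry.DiscreteGeometry.fccKissingPattern) : EuclideanSpace ℝ (Fin 3))) ≤ 1 / 20) ∨ (∃ e : ↥T ≃ ↥Literature.Geometry.DiscreteGeometry.hcpKissingPattern, ∀ t : ↥T, dist (d⁻¹ • ((t : EuclideanSpace ℝ (Fin 3)) - y)) (A ((e t : ↥Literature.Geometry.DiscreteGeometry.hcpKissingPattern) : EuclideanSpace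 ℝ (Fin 3))) ≤ 1 / 20))) → (∃ s : ℤ → ℤ, Literature.MathematicalPhysics.StatisticalMechanics.IsHaggSeq s ∧ ∃ Φ : EuclideanSpace ℝ (Fin 3) → EuclideanSpace ℝ (Fin 3), Set.BijOn Φ (Literature.MathematicalPhysics.StatisticalMechanics.barlowStacking 1 (Real.sqrt (2 / 3)) s) S ∧ ∀ p ∈ Literature.MathematicalPhysics.StatisticalMechanics.barlowStacking 1 (Real.sqrt (2 / 3)) s, ∃ A : EuclideanSpace ℝ (Fin 3) →ₗᵢ[ℝ] EuclideanSpace ℝ (Fin 3), ∃ l : ℝ, 0 < l ∧ ∀ q ∈ Literature.MathematicalPhysics.StatisticalMechanics.barlowStacking 1 (Real.sqrt (2 / 3)) s, dist q p ≤ 1 → dist (Φ q) (Φ p + l • A (q - p)) ≤ 1 / 20 * l)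

/-- item stmt-AtomisticToContinuum-0714 · support · rank 9 · closed · proved by Summit.AtomisticToContinuum.Crystallization.Theorems.crysPeriodicBddBelow_proof (prover) · by planner
sources: BlancLewin2015, tree:LennardJonesThermodynamicLimitProofs.lean
The Lennard-Jones energy per particle of periodic configurations of ℝ³ (any full-rank lattice, any
finite motif) is bounded below (by −B, the stability constant: finite blocks of Q as N-point
configurations, boundary O(N^{2/3}), r⁻⁶ tail summable in d = 3). Makes ⨅_Q e(Q) a genuine infimum
(ciInf_le usable) in 0626/0629 and in the periodisation lemma. -/
@[route_item "route-AtomisticToContinuum-HullExactificationCascade", crux]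
def CrysPeriodicBddBelow : Prop :=
  BddBelow (Set.range fun Q : Literature.MathematicalPhysics.StatisticalMechanics.PeriodicConfiguration 3 => Q.energyPerParticle Literature.MathematicalPhysics.StatisticalMechanics.lennardJones)

/-- `CrysPeriodicBddBelow` holds: proved by `Summit.AtomisticToContinuum.Crystallization.Theorems.crysPeriodicBddBelow_proof`. -/
theorem CrysPeriodicBddBelow_holds : CrysPeriodicBddBelow := _root_.Summit.AtomisticToContinuum.Crystallization.Theorems.crysPeriodicBddBelow_proof

/-- item stmt-AtomisticToContinuum-11865 · support · rank 9 · closed · proved by Summit.AtomisticToContinuum.Crystallization.Theorems.crysEnergyUpper_proof @ b1410290bb74 (prover) · by planner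
sources: BlancLewin2015, Theil2006
[support] trial-state upper bound limsup E(N)/N ≤ ⨅ over periodic Q of e_LJ(Q) (shared item 0629,
same signature: finite blocks of Q plus far-away extras, boundary O(N^{2/3}), r⁻⁶ tail summable in d
= 3; le_ciInf needs only Nonempty; coboundedness of the limsup from BlancLewin2015_8_holds /
lennardJones_stable_holds, both proved in tree). [difficulty: provable-now] -/
@[route_item "route-AtomisticToContinuum-HullExactificationCascade", crux]
def CrysEnergyUpper : Prop :=
  Filter.limsup (fun N : ℕ => Literature.MathematicalPhysics.StatisticalMechanics.groundStateEnergy Literature.MathematicalPhysics.StatisticalMechanics.lennardJones 3 N / N) Filter.atTop ≤ ⨅ Q : Literature.MathematicalPhysics.StatisticalMechanics.PeriodicConfiguration 3, Q.energyPerParticle Literature.MathematicalPhysics.StatisticalMechanics.lennardJones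

/-- `CrysEnergyUpper` holds: proved by `Summit.AtomisticToContinuum.Crystallization.Theorems.crysEnergyUpper_proof` @ b1410290bb74. -/
theorem CrysEnergyUpper_holds : CrysEnergyUpper := _root_.Summit.AtomisticToContinuum.Crystallization.Theorems.crysEnergyUpper_proof

/-- item stmt-AtomisticToContinuum-12089 · support · rank 9 · closed · proved by Summit.AtomisticToContinuum.Crystallization.Theorems.hullGoodEverywhere_proof @ ad04636dc0ed (prover) · by planner
sources: Radin1991, BlancLewin2015, AuYeungFrieseckeSchmidt2012, tree:CrystallizationLocalLimit.lean, tree:LennardJonesClusters.lean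
[support] (D) EXACTIFICATION no. 1 (card H1): if the 1/20-defect fraction of a sequence of LJ ground
states tends to 0 (A's conclusion for this x), some hull element S (two-sided ε-matching of
translates x^(φ j) + τ_j on every ball, eventually in j — the hypothesis shape of
PeriodicConfiguration.tendsto_sum_of_eventually_near') is δ-separated, contains 0, is EVERYWHERE
1/20-good and relatively dense. Pigeonhole gives particles with defect-free R_j-balls, R_j → ∞;
recentre; compactness of δ-separated sets (δ from LennardJonesMinimalDistance_holds) + diagonal
extraction; goodness (open outer cutoff, closed matching ≤ 1/20) passes to local limits; every
particle of a LJ ground state has a neighbour within a uniform R₀ (relocation gains ≥ 1/12), which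
bounds the local scale and, with full shells (covering radius 45°), gives relative denseness.
[difficulty: M] -/
@[route_item "route-AtomisticToContinuum-HullExactificationCascade", crux]
def HullGoodEverywhere : Prop :=
  ∀ (x : (N : ℕ) → (Fin N → EuclideanSpace ℝ (Fin 3))), (∀ N, Literature.MathematicalPhysics.StatisticalMechanics.IsGroundState Literature.MathematicalPhysics.StatisticalMechanics.lennardJones (x N)) → Filter.Tendsto (fun N : ℕ => (Nat.card {i : Fin N // ¬ (let d : ℝ := sInf ((fun z => dist z (x N i)) '' (Set.range (x N) \ {(x N i)})); let T : Set (EuclideanSpace ℝ (Fin 3)) := {z : EuclideanSpace ℝ (Fin 3) | z ∈ Set.range (x N) ∧ z ≠ (x N i) ∧ dist z (x N i) < 13 / 10 * d}; ∃ A : EuclideanSpace ℝ (Fin 3) →ₗᵢ[ℝ] EuclideanSpace ℝ (Fin 3), (∃ e : ↥T ≃ ↥Literature.Geometry.DiscreteGeometry.fccKissingPattern, ∀ t : ↥T, dist (d⁻¹ • ((t : EuclideanSpace ℝ (Fin 3)) - (x N i))) (A ((e t : ↥Literature.Geometry.DiscreteGeometry.fccKissingPattern) : EuclideanSpace ℝ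 (Fin 3))) ≤ 1 / 20) ∨ (∃ e : ↥T ≃ ↥Literature.Geometry.DiscreteGeometry.hcpKissingPattern, ∀ t : ↥T, dist (d⁻¹ • ((t : EuclideanSpace ℝ (Fin 3)) - (x N i))) (A ((e t : ↥Literature.Geometry.DiscreteGeometry.hcpKissingPattern) : EuclideanSpace ℝ (Fin 3))) ≤ 1 / 20))} : ℝ) / (N : ℝ)) Filter.atTop (nhds (0 : ℝ)) → ∃ S : Set (EuclideanSpace ℝ (Fin 3)), ∃ δ : ℝ, 0 < δ ∧ (∀ y ∈ S, ∀ z ∈ S, y ≠ z → δ ≤ dist y z) ∧ (0 : EuclideanSpace ℝ (Fin 3)) ∈ S ∧ (∃ φ : ℕ → ℕ, StrictMono φ ∧ ∃ τ : ℕ → EuclideanSpace ℝ (Fin 3), (∀ R ε : ℝ, 0 < ε → ∀ᶠ j : ℕ in Filter.atTop, (∀ s ∈ S, ‖s‖ ≤ R → ∃ i : Fin (φ j), dist (x (φ j) i + τ j) s ≤ ε) ∧ (∀ i : Fin (φ j), ‖x (φ j) i + τ j‖ ≤ R → ∃ s ∈ S, dist (x (φ j) i + τ j) s ≤ ε)))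 ∧ (∀ y ∈ S, (let d : ℝ := sInf ((fun z => dist z y) '' (S \ {y})); let T : Set (EuclideanSpace ℝ (Fin 3)) := {z : EuclideanSpace ℝ (Fin 3) | z ∈ S ∧ z ≠ y ∧ dist z y < 13 / 10 * d}; ∃ A : EuclideanSpace ℝ (Fin 3) →ₗᵢ[ℝ] EuclideanSpace ℝ (Fin 3), (∃ e : ↥T ≃ ↥Literature.Geometry.DiscreteGeometry.fccKissingPattern, ∀ t : ↥T, dist (d⁻¹ • ((t : EuclideanSpace ℝ (Fin 3)) - y)) (A ((e t : ↥Literature.Geometry.DiscreteGeometry.fccKissingPattern) : EuclideanSpace ℝ (Fin 3))) ≤ 1 / 20) ∨ (∃ e : ↥T ≃ ↥Literature.Geometry.DiscreteGeometry.hcpKissingPattern, ∀ t : ↥T, dist (d⁻¹ • ((t : EuclideanSpace ℝ (Fin 3)) - y)) (A ((e t : ↥Literature.Geometry.DiscreteGeometry.hcpKissingPattern) : EuclideanSpace ℝ (Fin 3))) ≤ 1 / 20))) ∧ (∃ R₁ : ℝ, ∀ p : EuclideanSpace ℝ (Fin 3), ∃ y ∈ S, dist y p ≤ R₁)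

/-- item stmt-AtomisticToContinuum-12090 · support · rank 9 · closed · proved by Summit.AtomisticToContinuum.Crystallization.Theorems.hullBulkOptimal_proof (prover) · by planner
sources: BlancLewin2015, tree:LennardJonesThermodynamicLimitProofs.lean, tree:LennardJonesClusters.lean
[support] (E) cut-and-paste (card H2): for LJ ground states x and every δ-separated hull element S:
∀ ε > 0 ∃ L₀ ∀ L ≥ L₀ ∀ c, Σ_{y ∈ S∩B_L(c)} Σ'_{z ∈ S, z ≠ y} V_LJ(|y − z|) ≤ 2·e_∞·#(S∩B_L(c)) +
εL³, e_∞ = liminf E(N)/N. Proof: with A_j the particles matched to S∩B_L(c), Σ siteE(A_j) =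
2E_self(A_j) + cross and cross ≥ −C_δL² (r⁻⁶ tail); removing A_j and re-inserting an optimal
n-cluster far away (interaction ≤ 0 beyond distance 1) must not lower the energy, so E_self + cross
≤ E(n), i.e. Σ siteE ≤ 2E(n) + C_δL² ≤ 2e_∞ n + 2ε'n + CL² (E(n)/n → e_∞ by BlancLewin2015_8_holds;
E(n) ≤ 0 for small n). [difficulty: M] -/
@[route_item "route-AtomisticToContinuum-HullExactificationCascade", crux]
def HullBulkOptimal : Prop :=
  ∀ (x : (N : ℕ) → (Fin N → EuclideanSpace ℝ (Fin 3))), (∀ N, Literature.MathematicalPhysics.StatisticalMechanics.IsGroundState Literature.MathematicalPhysics.StatisticalMechanics.lennardJones (x N)) → ∀ (S : Set (EuclideanSpace ℝ (Fin 3))) (δ : ℝ), 0 < δ → (∀ y ∈ S, ∀ z ∈ S, y ≠ z → δ ≤ dist y z) → (∃ φ : ℕ → ℕ, StrictMono φ ∧ ∃ τ : ℕ → EuclideanSpace ℝ (Fin 3), (∀ R ε : ℝ, 0 < ε → ∀ᶠ j : ℕ in Filter.atTop, (∀ s ∈ S, ‖s‖ ≤ R → ∃ i : Fin (φ j), dist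 (x (φ j) i + τ j) s ≤ ε) ∧ (∀ i : Fin (φ j), ‖x (φ j) i + τ j‖ ≤ R → ∃ s ∈ S, dist (x (φ j) i + τ j) s ≤ ε))) → ∀ ε : ℝ, 0 < ε → ∃ L₀ : ℝ, ∀ L : ℝ, L₀ ≤ L → ∀ c : EuclideanSpace ℝ (Fin 3), (∑' y : ↥{y : EuclideanSpace ℝ (Fin 3) | y ∈ S ∧ dist y c ≤ L}, (∑' z : ↥{z : EuclideanSpace ℝ (Fin 3) | z ∈ S ∧ z ≠ (y : EuclideanSpace ℝ (Fin 3))}, Literature.MathematicalPhysics.StatisticalMechanics.lennardJones (dist (y : EuclideanSpace ℝ (Fin 3)) (z : EuclideanSpace ℝ (Fin 3))))) ≤ 2 * (Filter.liminf (fun N : ℕ => Literature.MathematicalPhysics.StatisticalMechanics.groundStateEnergy Literature.MathematicalPhysics.StatisticalMechanics.lennardJones 3 N / (N : ℝ)) Filter.atTop) * (({y : EuclideanSpace ℝ (Fin 3) | y ∈ S ∧ dist y c ≤ L} : Set (EuclideanSpace ℝ (Fin 3))).ncard : ℝ) + ε * L ^ 3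

/-- item stmt-AtomisticToContinuum-12091 · support · rank 9 · closed · proved by Summit.AtomisticToContinuum.Crystallization.Theorems.hullDefectDensityZero_proof @ c72aee93d46f (prover) · by planner
sources: BlancLewin2015
[support] (F₀) real-number bookkeeping: for fixed a, h, S, the B-inequality for S, the E-inequality
for S and liminf E(N)/N ≤ e(hcp a h) give ∀ η > 0 ∀ θ > 0 ∃ L₀ ∀ L ≥ L₀ ∀ c, #bad_η(S∩B_L(c)) ≤ θL³
(take ε = κθ/2, absorb C(L+1)² for large L; n ≥ 0). Provable now. [difficulty: provable-now] -/
@[route_item "route-AtomisticToContinuum-HullExactificationCascade", crux]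
def HullDefectDensityZero : Prop :=
  ∀ a h : ℝ, ∀ ha : a ≠ 0, ∀ hh : h ≠ 0, ∀ S : Set (EuclideanSpace ℝ (Fin 3)), (∀ η : ℝ, 0 < η → ∃ κ : ℝ, 0 < κ ∧ ∃ C : ℝ, ∀ (c : EuclideanSpace ℝ (Fin 3)) (L : ℝ), 0 ≤ L → 2 * ((Literature.MathematicalPhysics.StatisticalMechanics.hcpPeriodicConfiguration ha hh).energyPerParticle Literature.MathematicalPhysics.StatisticalMechanics.lennardJones) * (({y : EuclideanSpace ℝ (Fin 3) | y ∈ S ∧ dist y c ≤ L} : Set (EuclideanSpace ℝ (Fin 3))).ncard : ℝ) + κ * (({y : EuclideanSpace ℝ (Fin 3) | y ∈ S ∧ dist y c ≤ L ∧ ¬ (let T : Set (EuclideanSpace ℝ (Fin 3)) := {z : EuclideanSpace ℝ (Fin 3) | z ∈ S ∧ z ≠ y ∧ dist z y < 13 / 10 * a}; let P : Set (EuclideanSpace ℝ (Fin 3)) := {p : EuclideanSpace ℝ (Fin 3) | p ∈ Literature.MathematicalPhysics.StatisticalMechanics.hcpStacking a h ∧ p ≠ 0 ∧ ‖p‖ <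 13 / 10 * a}; ∃ A : EuclideanSpace ℝ (Fin 3) →ₗᵢ[ℝ] EuclideanSpace ℝ (Fin 3), ∃ e : ↥T ≃ ↥P, ∀ t : ↥T, dist ((t : EuclideanSpace ℝ (Fin 3)) - y) (A ((e t : ↥P) : EuclideanSpace ℝ (Fin 3))) ≤ η)} : Set (EuclideanSpace ℝ (Fin 3))).ncard : ℝ) - C * (L + 1) ^ 2 ≤ (∑' y : ↥{y : EuclideanSpace ℝ (Fin 3) | y ∈ S ∧ dist y c ≤ L}, (∑' z : ↥{z : EuclideanSpace ℝ (Fin 3) | z ∈ S ∧ z ≠ (y : EuclideanSpace ℝ (Fin 3))}, Literature.MathematicalPhysics.StatisticalMechanics.lennardJones (dist (y : EuclideanSpace ℝ (Fin 3)) (z : EuclideanSpace ℝ (Fin 3)))))) → (∀ ε : ℝ, 0 < ε → ∃ L₀ : ℝ, ∀ L : ℝ, L₀ ≤ L → ∀ c : EuclideanSpace ℝ (Fin 3), (∑' y : ↥{y : EuclideanSpace ℝ (Fin 3) | y ∈ S ∧ dist y c ≤ L}, (∑' z : ↥{z : EuclideanSpace ℝ (Fin 3) | z ∈ S ∧ z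 ≠ (y : EuclideanSpace ℝ (Fin 3))}, Literature.MathematicalPhysics.StatisticalMechanics.lennardJones (dist (y : EuclideanSpace ℝ (Fin 3)) (z : EuclideanSpace ℝ (Fin 3))))) ≤ 2 * (Filter.liminf (fun N : ℕ => Literature.MathematicalPhysics.StatisticalMechanics.groundStateEnergy Literature.MathematicalPhysics.StatisticalMechanics.lennardJones 3 N / (N : ℝ)) Filter.atTop) * (({y : EuclideanSpace ℝ (Fin 3) | y ∈ S ∧ dist y c ≤ L} : Set (EuclideanSpace ℝ (Fin 3))).ncard : ℝ) + ε * L ^ 3) → (Filter.liminf (fun N : ℕ => Literature.MathematicalPhysics.StatisticalMechanics.groundStateEnergy Literature.MathematicalPhysics.StatisticalMechanics.lennardJones 3 N / (N : ℝ)) Filter.atTop) ≤ ((Literature.MathematicalPhysics.StatisticalMechanics.hcpPeriodicConfiguration ha hh).energyPerParticle Literature.MathematicalPhysics.StatisticalMechanics.lennardJones) → (∀ η : ℝ, 0 < η → ∀ θ : ℝ, 0 < θ → ∃ L₀ : ℝ, ∀ L : ℝ, L₀ ≤ L → ∀ c : EuclideanSpace ℝ (Fin 3), (({y : EuclideanSpace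 ℝ (Fin 3) | y ∈ S ∧ dist y c ≤ L ∧ ¬ (let T : Set (EuclideanSpace ℝ (Fin 3)) := {z : EuclideanSpace ℝ (Fin 3) | z ∈ S ∧ z ≠ y ∧ dist z y < 13 / 10 * a}; let P : Set (EuclideanSpace ℝ (Fin 3)) := {p : EuclideanSpace ℝ (Fin 3) | p ∈ Literature.MathematicalPhysics.StatisticalMechanics.hcpStacking a h ∧ p ≠ 0 ∧ ‖p‖ < 13 / 10 * a}; ∃ A : EuclideanSpace ℝ (Fin 3) →ₗᵢ[ℝ] EuclideanSpace ℝ (Fin 3), ∃ e : ↥T ≃ ↥P, ∀ t : ↥T, dist ((t : EuclideanSpace ℝ (Fin 3)) - y) (A ((e t : ↥P) : EuclideanSpace ℝ (Fin 3))) ≤ η)} : Set (EuclideanSpace ℝ (Fin 3))).ncard : ℝ) ≤ θ * L ^ 3)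

/-- item stmt-AtomisticToContinuum-12092 · support · rank 9 · closed · proved by Summit.AtomisticToContinuum.Crystallization.Theorems.HullExactShells.hullExactShells_proof @ 84c1cc9ab443 (prover) · by planner
sources: Radin1991, BlancLewin2015, tree:CrystallizationLocalLimit.lean
[support] (F) EXACTIFICATION no. 2, inside the hull (card H1 again): a δ-separated, relatively dense
hull element S of x whose η-bad points have density zero uniformly over balls for EVERY η > 0 yields
a hull element S₂ ∋ 0, δ-separated, every point of which is η-good for every η > 0. Grid/pigeonhole
gives η_k-bad-free balls B_(L_k)(y_k) ⊆ S with y_k ∈ S (relative denseness), L_k → ∞, η_k → 0; a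
local limit of S − y_k exists (compactness) and lies in Ω(x) (limits of limits, diagonal argument);
η-goodness (open cutoff 13/10·a, closed matching ≤ η, shells of exactly 12 points at norms < 1.3a)
passes to limits and is monotone in η. [difficulty: M] -/
@[route_item "route-AtomisticToContinuum-HullExactificationCascade", crux]
def HullExactShells : Prop :=
  ∀ (x : (N : ℕ) → (Fin N → EuclideanSpace ℝ (Fin 3))), (∀ N, Literature.MathematicalPhysics.StatisticalMechanics.IsGroundState Literature.MathematicalPhysics.StatisticalMechanics.lennardJones (x N)) → ∀ (a h : ℝ) (S : Set (EuclideanSpace ℝ (Fin 3))) (δ : ℝ), 0 < δ → 0 < a → (∀ y ∈ S, ∀ z ∈ S, y ≠ z → δ ≤ dist y z) → (∃ φ : ℕ → ℕ, StrictMono φ ∧ ∃ τ : ℕ → EuclideanSpace ℝ (Fin 3), (∀ R ε : ℝ, 0 < ε → ∀ᶠ j : ℕ in Filter.atTop, (∀ s ∈ S, ‖s‖ ≤ R → ∃ i : Fin (φ j), dist (x (φ j) i + τ j) s ≤ ε) ∧ (∀ i : Fin (φ j), ‖x (φ j) i + τ j‖ ≤ R → ∃ s ∈ S, dist (x (φ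 j) i + τ j) s ≤ ε))) → (∃ R₁ : ℝ, ∀ p : EuclideanSpace ℝ (Fin 3), ∃ y ∈ S, dist y p ≤ R₁) → (∀ η : ℝ, 0 < η → ∀ θ : ℝ, 0 < θ → ∃ L₀ : ℝ, ∀ L : ℝ, L₀ ≤ L → ∀ c : EuclideanSpace ℝ (Fin 3), (({y : EuclideanSpace ℝ (Fin 3) | y ∈ S ∧ dist y c ≤ L ∧ ¬ (let T : Set (EuclideanSpace ℝ (Fin 3)) := {z : EuclideanSpace ℝ (Fin 3) | z ∈ S ∧ z ≠ y ∧ dist z y < 13 / 10 * a}; let P : Set (EuclideanSpace ℝ (Fin 3)) := {p : EuclideanSpace ℝ (Fin 3) | p ∈ Literature.MathematicalPhysics.StatisticalMechanics.hcpStacking a h ∧ p ≠ 0 ∧ ‖p‖ < 13 / 10 * a}; ∃ A : EuclideanSpace ℝ (Fin 3) →ₗᵢ[ℝ] EuclideanSpace ℝ (Fin 3), ∃ e : ↥T ≃ ↥P, ∀ t : ↥T, dist ((t : EuclideanSpace ℝ (Fin 3)) - y) (A ((e t : ↥P) : EuclideanSpace ℝ (Fin 3))) ≤ η)} : Set (EuclideanSpace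 ℝ (Fin 3))).ncard : ℝ) ≤ θ * L ^ 3) → ∃ S₂ : Set (EuclideanSpace ℝ (Fin 3)), (∀ y ∈ S₂, ∀ z ∈ S₂, y ≠ z → δ ≤ dist y z) ∧ (0 : EuclideanSpace ℝ (Fin 3)) ∈ S₂ ∧ (∃ φ : ℕ → ℕ, StrictMono φ ∧ ∃ τ : ℕ → EuclideanSpace ℝ (Fin 3), (∀ R ε : ℝ, 0 < ε → ∀ᶠ j : ℕ in Filter.atTop, (∀ s ∈ S₂, ‖s‖ ≤ R → ∃ i : Fin (φ j), dist (x (φ j) i + τ j) s ≤ ε) ∧ (∀ i : Fin (φ j), ‖x (φ j) i + τ j‖ ≤ R → ∃ s ∈ S₂, dist (x (φ j) i + τ j) s ≤ ε))) ∧ ∀ y ∈ S₂, ∀ η : ℝ, 0 < η → (let T : Set (EuclideanSpace ℝ (Fin 3)) := {z : EuclideanSpace ℝ (Fin 3) | z ∈ S₂ ∧ z ≠ y ∧ dist z y < 13 / 10 * a}; let P : Set (EuclideanSpace ℝ (Fin 3)) := {p : EuclideanSpace ℝ (Fin 3) | p ∈ Literature.MathematicalPhysics.StatisticalMechanics.hcpStacking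 a h ∧ p ≠ 0 ∧ ‖p‖ < 13 / 10 * a}; ∃ A : EuclideanSpace ℝ (Fin 3) →ₗᵢ[ℝ] EuclideanSpace ℝ (Fin 3), ∃ e : ↥T ≃ ↥P, ∀ t : ↥T, dist ((t : EuclideanSpace ℝ (Fin 3)) - y) (A ((e t : ↥P) : EuclideanSpace ℝ (Fin 3))) ≤ η)

/-- item stmt-AtomisticToContinuum-12093 · support · rank 9 · closed · proved by Summit.AtomisticToContinuum.Crystallization.Theorems.exactHcpLocalTheorem_proof @ ad04636dc0ed (prover) · by planner
sources: HalesDSP2012, Hales2012, tree:LayerStackings.lean, ConwaySloane1999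
[support] (G) η = 0 HCP LOCAL THEOREM, valid OFF the ideal ratio: for 9/10 < a < 1, |h − a√(2/3)| ≤
a/100 and nonempty S ⊆ ℝ³ whose every point has its unscaled 13/10·a-shell η-congruent (linear
isometry + bijection) to the 12-point shell of hcpStacking a h at 0 for every η > 0 (hence exactly
congruent: O(3) compact, finitely many bijections), S = g(hcpStacking a h) for an isometry g. Ideal
ratio: scale by 2/a, every tangent arrangement is the HCP pattern ⟹ HalesDSP_layerPackings_holds
gives a Barlow stacking, all layers h-type ⟹ Hägg sequence alternating ⟹ hcp; off-ideal: 6 shell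
points at a (hexagon) and 6 at √(a²/3 + h²) ≠ a pin the layer plane, which propagates through 3
shared non-collinear points; uniqueness of the extension at each step is a finite check on 5-point
sub-configurations of the anticuboctahedron; a second copy is excluded because hcp has covering
radius < a. [difficulty: M] -/
@[route_item "route-AtomisticToContinuum-HullExactificationCascade", crux]
def ExactHcpLocalTheorem : Prop :=
  ∀ a h : ℝ, (9 / 10 < a ∧ a < 1 ∧ |h - a * Real.sqrt (2 / 3)| ≤ a / 100) → ∀ S : Set (EuclideanSpace ℝ (Fin 3)), S.Nonempty → (∀ y ∈ S, ∀ η : ℝ, 0 < η → (let T : Set (EuclideanSpace ℝ (Fin 3)) := {z : EuclideanSpace ℝ (Fin 3) | z ∈ S ∧ z ≠ y ∧ dist z y < 13 / 10 * a}; let P : Set (EuclideanSpace ℝ (Fin 3)) := {p : EuclideanSpace ℝ (Fin 3) | p ∈ Literature.MathematicalPhysics.StatisticalMechanics.hcpStacking a h ∧ p ≠ 0 ∧ ‖p‖ < 13 / 10 * a}; ∃ A : EuclideanSpace ℝ (Fin 3) →ₗᵢ[ℝ] EuclideanSpace ℝ (Fin 3), ∃ e : ↥T ≃ ↥P, ∀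 t : ↥T, dist ((t : EuclideanSpace ℝ (Fin 3)) - y) (A ((e t : ↥P) : EuclideanSpace ℝ (Fin 3))) ≤ η)) → ∃ g : EuclideanSpace ℝ (Fin 3) ≃ᵢ EuclideanSpace ℝ (Fin 3), S = g '' Literature.MathematicalPhysics.StatisticalMechanics.hcpStacking a h

/-- item stmt-AtomisticToContinuum-12094 · support · rank 9 · closed · proved by Summit.AtomisticToContinuum.Crystallization.Theorems.hullPeriodicCrystallizes_proof @ 045c7b513df3 (prover) · by planner
sources: BlancLewin2015, tree:CrystallizationLocalLimit.lean, tree:CrystallizationSymmetries.lean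
[support] (H) a periodic point set in the hull gives Blanc–Lewin (16): if some hull element of the
LJ ground states x is g(P.points) for a PeriodicConfiguration P and an isometry g, the
IsCrystallizing clause holds for x with multiplicity m ≡ 1: g(P.points) = (isometryImage/translate
of P).points (CrystallizationSymmetries.lean), LennardJonesMinimalDistance_holds gives the
separation, and the matching is literally hypothesis h of
PeriodicConfiguration.tendsto_sum_of_eventually_near'. Provable now. [difficulty: provable-now] -/
@[route_item "route-AtomisticToContinuum-HullExactificationCascade", crux]
def HullPeriodicCrystallizes : Prop :=
  ∀ (x : (N : ℕ) → (Fin N → EuclideanSpace ℝ (Fin 3))), (∀ N, Literature.MathematicalPhysics.StatisticalMechanics.IsGroundState Literature.MathematicalPhysics.StatisticalMechanics.lennardJones (x N)) → (∃ (P : Literature.MathematicalPhysics.StatisticalMechanics.PeriodicConfiguration 3) (g : EuclideanSpace ℝ (Fin 3) ≃ᵢ EuclideanSpace ℝ (Fin 3)), (∃ φ : ℕ → ℕ, StrictMono φ ∧ ∃ τ : ℕ → EuclideanSpace ℝ (Fin 3), (∀ R ε : ℝ, 0 < ε → ∀ᶠ j : ℕ in Filter.atTop, (∀ s ∈ (g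 '' P.points), ‖s‖ ≤ R → ∃ i : Fin (φ j), dist (x (φ j) i + τ j) s ≤ ε) ∧ (∀ i : Fin (φ j), ‖x (φ j) i + τ j‖ ≤ R → ∃ s ∈ (g '' P.points), dist (x (φ j) i + τ j) s ≤ ε)))) → ∃ (φ : ℕ → ℕ) (τ : ℕ → EuclideanSpace ℝ (Fin 3)) (P : Literature.MathematicalPhysics.StatisticalMechanics.PeriodicConfiguration 3) (m : EuclideanSpace ℝ (Fin 3) → ℕ), StrictMono φ ∧ (∀ s ∈ P.points, 1 ≤ m s) ∧ (∀ g ∈ P.lattice, ∀ s, m (s + g) = m s) ∧ ∀ f : EuclideanSpace ℝ (Fin 3) → ℝ, Continuous f → HasCompactSupport f → Filter.Tendsto (fun j => ∑ i : Fin (φ j), f (x (φ j) i + τ j)) Filter.atTop (nhds (∑' s : P.points, (m s : ℝ) * f s))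

/-- item stmt-AtomisticToContinuum-12095 · support · rank 9 · closed · proved by Summit.AtomisticToContinuum.Crystallization.Theorems.hullEnergyLowerBound_proof @ d4edf071e019 (prover) · by planner
sources: BlancLewin2015
[support] (J) conjunct (i) from the hull: for a ≠ 0, h ≠ 0 and a δ-separated, relatively dense S
carrying the B-inequality (η = 1, κ-term dropped) and the E-inequality, e(hcpPeriodicConfiguration a
h) ≤ liminf E(N)/N: 2e*·n_L − C(L+1)² ≤ Σ ≤ 2e_∞·n_L + εL³ on balls B_L(0), and relative denseness +
separation give n_L ≥ c₀L³, so e* − e_∞ ≤ (εL³ + C(L+1)²)/(2c₀L³) → ε/(2c₀) → 0. Provable now.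
[difficulty: provable-now] -/
@[route_item "route-AtomisticToContinuum-HullExactificationCascade", crux]
def HullEnergyLowerBound : Prop :=
  ∀ a h : ℝ, ∀ ha : a ≠ 0, ∀ hh : h ≠ 0, ∀ (S : Set (EuclideanSpace ℝ (Fin 3))) (δ : ℝ), 0 < δ → (∀ y ∈ S, ∀ z ∈ S, y ≠ z → δ ≤ dist y z) → (∃ R₁ : ℝ, ∀ p : EuclideanSpace ℝ (Fin 3), ∃ y ∈ S, dist y p ≤ R₁) → (∀ η : ℝ, 0 < η → ∃ κ : ℝ, 0 < κ ∧ ∃ C : ℝ, ∀ (c : EuclideanSpace ℝ (Fin 3)) (L : ℝ), 0 ≤ L → 2 * ((Literature.MathematicalPhysics.StatisticalMechanics.hcpPeriodicConfiguration ha hh).energyPerParticle Literature.MathematicalPhysics.StatisticalMechanics.lennardJones) * (({y : EuclideanSpace ℝ (Fin 3) | y ∈ S ∧ dist y c ≤ L} : Set (EuclideanSpace ℝ (Fin 3))).ncard : ℝ) + κ * (({y : EuclideanSpace ℝ (Fin 3) | y ∈ S ∧ dist y c ≤ L ∧ ¬ (let T : Set (EuclideanSpace ℝ (Fin 3)) :=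 {z : EuclideanSpace ℝ (Fin 3) | z ∈ S ∧ z ≠ y ∧ dist z y < 13 / 10 * a}; let P : Set (EuclideanSpace ℝ (Fin 3)) := {p : EuclideanSpace ℝ (Fin 3) | p ∈ Literature.MathematicalPhysics.StatisticalMechanics.hcpStacking a h ∧ p ≠ 0 ∧ ‖p‖ < 13 / 10 * a}; ∃ A : EuclideanSpace ℝ (Fin 3) →ₗᵢ[ℝ] EuclideanSpace ℝ (Fin 3), ∃ e : ↥T ≃ ↥P, ∀ t : ↥T, dist ((t : EuclideanSpace ℝ (Fin 3)) - y) (A ((e t : ↥P) : EuclideanSpace ℝ (Fin 3))) ≤ η)} : Set (EuclideanSpace ℝ (Fin 3))).ncard : ℝ) - C * (L + 1) ^ 2 ≤ (∑' y : ↥{y : EuclideanSpace ℝ (Fin 3) | y ∈ S ∧ dist y c ≤ L}, (∑' z : ↥{z : EuclideanSpace ℝ (Fin 3) | z ∈ S ∧ z ≠ (y : EuclideanSpace ℝ (Fin 3))}, Literature.MathematicalPhysics.StatisticalMechanics.lennardJones (dist (y : EuclideanSpace ℝ (Fin 3)) (z : EuclideanSpace ℝ (Fin 3)))))) → (∀ ε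 : ℝ, 0 < ε → ∃ L₀ : ℝ, ∀ L : ℝ, L₀ ≤ L → ∀ c : EuclideanSpace ℝ (Fin 3), (∑' y : ↥{y : EuclideanSpace ℝ (Fin 3) | y ∈ S ∧ dist y c ≤ L}, (∑' z : ↥{z : EuclideanSpace ℝ (Fin 3) | z ∈ S ∧ z ≠ (y : EuclideanSpace ℝ (Fin 3))}, Literature.MathematicalPhysics.StatisticalMechanics.lennardJones (dist (y : EuclideanSpace ℝ (Fin 3)) (z : EuclideanSpace ℝ (Fin 3))))) ≤ 2 * (Filter.liminf (fun N : ℕ => Literature.MathematicalPhysics.StatisticalMechanics.groundStateEnergy Literature.MathematicalPhysics.StatisticalMechanics.lennardJones 3 N / (N : ℝ)) Filter.atTop) * (({y : EuclideanSpace ℝ (Fin 3) | y ∈ S ∧ dist y c ≤ L} : Set (EuclideanSpace ℝ (Fin 3))).ncard : ℝ) + ε * L ^ 3) → ((Literature.MathematicalPhysics.StatisticalMechanics.hcpPeriodicConfiguration ha hh).energyPerParticle Literature.MathematicalPhysics.StatisticalMechanics.lennardJones) ≤ (Filter.liminf (fun N : ℕ => Literature.MathematicalPhysics.StatisticalMechanics.groundStateEnergy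 Literature.MathematicalPhysics.StatisticalMechanics.lennardJones 3 N / (N : ℝ)) Filter.atTop)

/-- item stmt-AtomisticToContinuum-12096 · assembly · rank 1 · closed · proved by Summit.AtomisticToContinuum.Crystallization.Theorems.hullExactificationCascade_assembly_proof (prover) · by planner
sources: BlancLewin2015
[assembly] A → B → C → D → E → F₀ → F → G → H → I₁ → I₂ → J → Crystallization (pure logic +
BlancLewin2015_8_holds, LennardJonesGroundStatesExist_holds, hcpPeriodicConfiguration_points,
ciInf_le). -/
@[route_item "route-AtomisticToContinuum-HullExactificationCascade"]
def Assembly : Prop :=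
  ZeroDefectDensity → HcpLandscapeGap → RobustBarlowTemplate → HullGoodEverywhere → HullBulkOptimal → HullDefectDensityZero → HullExactShells → ExactHcpLocalTheorem → HullPeriodicCrystallizes → CrysEnergyUpper → CrysPeriodicBddBelow → HullEnergyLowerBound → _root_.Crystallization

/-! D-0027 §2.1 — DECIDING THEOREM (planner-authored via `route open/edit --closes-file`; by planner-plancard-AtomisticToContinuum-Crystal-79d27627-g2-0 2026-08-15T18:49:34Z):
its hypotheses are this route's items and its conclusion the sub-problem Statement (glue_lint), and it elaborates with this file. -/

@[closes "route-AtomisticToContinuum-HullExactificationCascade"] theorem closes : ZeroDefectDensity → HcpLandscapeGap → RobustBarlowTemplate → HullGoodEverywhere →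
    HullBulkOptimal → HullDefectDensityZero → HullExactShells → ExactHcpLocalTheorem →
    HullPeriodicCrystallizes → CrysEnergyUpper → CrysPeriodicBddBelow → HullEnergyLowerBound →
    _root_.Crystallization := by
  intro hA hB hC hD hE hF₀ hF hG hH hI₁ hI₂ hJ
  obtain ⟨a, h, ha, hh, hbox, hBmat⟩ := hB
  have ha0 : (0 : ℝ) < a := lt_trans (by norm_num) hbox.1
  obtain ⟨e, -, he_tend, -⟩ :=
    Literature.MathematicalPhysics.StatisticalMechanics.BlancLewin2015_8_holds 3 (by norm_num) (by norm_num)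
  have hliminf : Filter.liminf (fun N : ℕ =>
      Literature.MathematicalPhysics.StatisticalMechanics.groundStateEnergy
        Literature.MathematicalPhysics.StatisticalMechanics.lennardJones 3 N / (N : ℝ)) Filter.atTop = e :=
    he_tend.liminf_eq
  have hlimsup : Filter.limsup (fun N : ℕ =>
      Literature.MathematicalPhysics.StatisticalMechanics.groundStateEnergy
        Literature.MathematicalPhysics.StatisticalMechanics.lennardJones 3 N / (N : ℝ)) Filter.atTop = e :=
    he_tend.limsup_eq
  have h_e_le_inf : e ≤ ⨅ Q : Literature.MathematicalPhysics.StatisticalMechanics.PeriodicConfiguration 3,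
      Q.energyPerParticle Literature.MathematicalPhysics.StatisticalMechanics.lennardJones := by
    rw [← hlimsup]; exact hI₁
  have h_inf_le : (⨅ Q : Literature.MathematicalPhysics.StatisticalMechanics.PeriodicConfiguration 3,
      Q.energyPerParticle Literature.MathematicalPhysics.StatisticalMechanics.lennardJones) ≤
      (Literature.MathematicalPhysics.StatisticalMechanics.hcpPeriodicConfiguration ha hh).energyPerParticle
        Literature.MathematicalPhysics.StatisticalMechanics.lennardJones :=
    ciInf_le hI₂ _
  change Literature.MathematicalPhysics.StatisticalMechanics.HasPeriodicGroundStateEnergy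
      Literature.MathematicalPhysics.StatisticalMechanics.lennardJones 3 ∧
    Literature.MathematicalPhysics.StatisticalMechanics.IsCrystallizing
      Literature.MathematicalPhysics.StatisticalMechanics.lennardJones 3
  refine ⟨?_, ?_⟩
  · -- conjunct (i): the hull of SOME ground-state sequence pins e_∞ = e(hcp a h) = min
    choose x₀ hx₀ using
      Literature.MathematicalPhysics.StatisticalMechanics.LennardJonesGroundStatesExist_holds
    obtain ⟨S, δ, hδ, hsep, h0, hhull, hgood, hdense⟩ := hD x₀ hx₀ (hA x₀ hx₀)
    obtain htempl := hC δ hδ S ⟨0, h0⟩ hsep hgood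
    have hlow := hJ a h ha hh S δ hδ hsep hdense (by
        intro η hη
        obtain ⟨κ, hκ, C, hall⟩ := hBmat δ hδ η hη
        exact ⟨κ, hκ, C, fun c L hL => hall S hsep hgood htempl c L hL⟩)
      (hE x₀ hx₀ S δ hδ hsep hhull)
    rw [hliminf] at hlow
    have he_eq : e = (Literature.MathematicalPhysics.StatisticalMechanics.hcpPeriodicConfiguration ha
        hh).energyPerParticle Literature.MathematicalPhysics.StatisticalMechanics.lennardJones :=
      le_antisymm (h_e_le_inf.trans h_inf_le) hlow
    refine ⟨Literature.MathematicalPhysics.StatisticalMechanics.hcpPeriodicConfiguration ha hh,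
      ⟨⟨_, rfl⟩, ?_⟩, ?_⟩
    · rintro _ ⟨Q, rfl⟩
      exact he_eq.symm.le.trans (h_e_le_inf.trans (ciInf_le hI₂ Q))
    · rw [← he_eq]; exact he_tend
  · -- conjunct (ii): exactification cascade inside the hull of an ARBITRARY ground-state sequence
    intro x hx
    obtain ⟨S, δ, hδ, hsep, h0, hhull, hgood, hdense⟩ := hD x hx (hA x hx)
    obtain htempl := hC δ hδ S ⟨0, h0⟩ hsep hgood
    have hdens := hF₀ a h ha hh S (by
        intro η hη
        obtain ⟨κ, hκ, C, hall⟩ := hBmat δ hδ η hη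
        exact ⟨κ, hκ, C, fun c L hL => hall S hsep hgood htempl c L hL⟩)
      (hE x hx S δ hδ hsep hhull) (by rw [hliminf]; exact h_e_le_inf.trans h_inf_le)
    obtain ⟨S₂, hsep₂, h0₂, hhull₂, hgood₂⟩ := hF x hx a h S δ hδ ha0 hsep hhull hdense hdens
    obtain ⟨g, hg⟩ := hG a h hbox S₂ ⟨0, h0₂⟩ hgood₂
    exact hH x hx ⟨Literature.MathematicalPhysics.StatisticalMechanics.hcpPeriodicConfiguration ha hh, g, by
      rw [Literature.MathematicalPhysics.StatisticalMechanics.hcpPeriodicConfiguration_points, ← hg]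
      exact hhull₂⟩

end Summit.AtomisticToContinuum.Crystallization.Theses.HullExactificationCascade
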